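import Mathlib
import HarnessLib

/-!
# Compact support on `G ⧸ H` from compact support modulo `H` (route `IrreducibilityBySelfDuality`, input `PairLBoundaryJS`)

Helper for item stmt-Langlands-13622 (Jacquet–Shalika boundary theorem for the partial
Rankin–Selberg product), line `Sketch`, card "compact-kirillov-local-division": the local
Rankin–Selberg zeta integral over `GL_m(F) ⧸ U_m` has a kernel of the shape
`x ↦ Quotient.liftOn' x f _` for a right-`U_m`-invariant integrand `f` on `GL_m(F)` supported in
`C * U_m` with `C` compact.  This file supplies the generic topological-group fact: for a closed
subgroup `H` of a topological group `G` and a right-`H`-invariant `f : G → ℂ` whose support lies in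
`C * H` with `C` compact, the descended function on `G ⧸ H` has compact support
(`hasCompactSupport_quotientLiftOn_of_support_subset`).

Proof: the image `K` of `C` in `G ⧸ H` is compact (`QuotientGroup.continuous_mk`); outside `K` the
lift vanishes, since `f g ≠ 0` forces `g = c * h` with `c ∈ C`, `h ∈ H`, whence `↑g = ↑c ∈ K`;
and `G ⧸ H` is Hausdorff for closed `H` (`QuotientGroup.instT2Space`), so
`HasCompactSupport.intro` applies.
-/

noncomputable section

-- `Summit.Langlands.Langlands.…` (summit = sub-problem name, D-0017 layout) trips `dupNamespace`
set_option linter.dupNamespace false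

open scoped Pointwise Topology

namespace Summit.Langlands.Langlands.Theorems

/-- **Compact support modulo a closed subgroup descends to compact support on the quotient.**
Let `H` be a closed subgroup of a topological group `G` and `f : G → ℂ` a function constant on
the left cosets `g H` (i.e. right-`H`-invariant) whose support is contained in `C * H` for a
compact set `C ⊆ G`.  Then the function `G ⧸ H → ℂ` obtained by descending `f` has compact
support. -/
theorem hasCompactSupport_quotientLiftOn_of_support_subset {G : Type*} [Group G]
    [TopologicalSpace G] [IsTopologicalGroup G] (H : Subgroup G) [IsClosed (H : Set G)]
    {f : G → ℂ} (hinv : ∀ a b : G, @Setoid.r _ (QuotientGroup.leftRel H) a b → f a = f b)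
    {C : Set G} (hC : IsCompact C) (hsupp : Function.support f ⊆ C * (H : Set G)) :
    HasCompactSupport fun x : G ⧸ H => Quotient.liftOn' x f hinv := by
  haveI : T2Space (G ⧸ H) := inferInstance
  have hK : IsCompact ((QuotientGroup.mk : G → G ⧸ H) '' C) :=
    hC.image QuotientGroup.continuous_mk
  refine HasCompactSupport.intro hK fun x hx => ?_
  induction x using QuotientGroup.induction_on with
  | H g =>
    change f g = 0
    by_contra hg
    obtain ⟨c, hc, h, hh, rfl⟩ := Set.mem_mul.1 (hsupp (Function.mem_support.2 hg))
    refine hx ⟨c, hc, ?_⟩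
    exact QuotientGroup.eq.2 (by simpa using hh)
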